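import Summits.HodgeConjecture.CorCM.Census.OcticTwistScrewLaw
import Summits.HodgeConjecture.CorCM.Census.OcticTwistNoScrew

/-!
# The octic twist `(ℤ/8 × B, (4,0))`, XXIX: THE COMPLETE OCTIC LAW — `μ_hodge(ℤ/8 × B, (4,0)) = β − 1 − [∃ t ∈ B, 8 ∣ ord t]` for every
# finite group `B` of order `≥ 3`

COR-CM (cell `pub-hodgecm2`), count-neutral kernel combinatorics by the binder seat b09 (gen 35; lane COINVARIANT-TWIST / OCTIC RECON), the
capstone of the octic chain `Census/OcticTwist*.lean` (parts I–XXVIII, gens 33–35): part XXIII `octicTwist_law_noScrew` (no element of order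
divisible by `8`: `μ = β − 1`, generation by rank-four faces, Hodge-intrinsic floor by block parities + the half-parity functional) and part
XXVIII `octicTwist_law_screw` (an element of order divisible by `8`: `μ = β − 2`, generation by rank-four faces with the Weil lift handed over by
a screw pair type, ambient floor by block parities) BY NAME.  One theorem; no definition, no certificate, no named fact, no `sorry`.
HONEST FRAMING: `HC_CM` is NOT proved, here or anywhere in the tree; nothing here is a period or a headline.

**`octicTwist_complete_law`** (`|B| ≥ 3`, any finite group `B`, abelian or not): with `δ = 2` if `B` has an element of order divisible by `8`
and `δ = 1` otherwise, (i) there is a family `S` of octic rank-four faces (coset and mixed faces) with `hodge₂ B ≤ pairs₂ B ⊔ spanMot B S` and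
`|S| + δ = β = #Orb₂ B`; (ii) every family `S ⊆ hodge₂ B` with `hodge₂ B ≤ pairs₂ B ⊔ spanMot B S` has `β ≤ |S| + δ`.  This is the `j = 2` row
of the twist census (`Census/CoinvariantTwistLaw.lean`: `φ₂(⟨u⟩·B, u⁴) + 1 + [∃ b ∈ B, 8 ∣ ord b] = β`): **`μ_hodge = φ₂`** for every octic
twist, as for every quartic twist (`Census/QuarticTwistNoScrew.lean` `quarticTwist_complete_law`).  All [folklore].

## References
* [Pohlmann1968] H. Pohlmann, Algebraic cycles on abelian varieties of complex multiplication type, Ann. of Math. 88 (1968), Thm 1.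
* [Milne1999] J. S. Milne, Lefschetz motives and the Tate conjecture, Compositio Math. 117 (1999), Prop. 2.1, p. 54.
-/

namespace Summit.HodgeConjecture.CorCM.Census.OcticTwist

open Finset
open Summit.HodgeConjecture.CorCM.Census.QuarticTwist

variable (B : Type) [AddGroup B] [Fintype B] [DecidableEq B]

open Classical in
/-- **THE COMPLETE OCTIC LAW: `μ_hodge(ℤ/8 × B, (4,0)) = β − 1 − [∃ t ∈ B, 8 ∣ ord t]` FOR EVERY FINITE GROUP `B` OF ORDER `≥ 3`**, attained by
octic rank-four faces; the floor holds for every generating family of octic Hodge vectors. [folklore] -/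
theorem octicTwist_complete_law (h3 : 3 ≤ Fintype.card B) :
    (∃ S : Finset (Ty₂ B → ℤ), (∀ f ∈ S, IsFace₂ B f) ∧ hodge₂ B ≤ pairs₂ B ⊔ spanMot B S ∧
        S.card + (if ∃ t : B, 8 ∣ addOrderOf t then 2 else 1) = Fintype.card (Orb₂ B)) ∧
      ∀ S : Finset (Ty₂ B → ℤ), (∀ v ∈ S, v ∈ hodge₂ B) → hodge₂ B ≤ pairs₂ B ⊔ spanMot B S →
        Fintype.card (Orb₂ B) ≤ S.card + (if ∃ t : B, 8 ∣ addOrderOf t then 2 else 1) := by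
  by_cases h8 : ∃ t : B, 8 ∣ addOrderOf t
  · simp only [if_pos h8]
    obtain ⟨hgen, hfloor⟩ := octicTwist_law_screw B h3 h8
    exact ⟨hgen, fun S _ hS => hfloor S hS⟩
  · simp only [if_neg h8]
    exact octicTwist_law_noScrew B h3 (fun t ht => h8 ⟨t, ht⟩)

end Summit.HodgeConjecture.CorCM.Census.OcticTwist
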